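import Summits.ResolutionOfSingularities.ResolutionOfSingularities.Theorems.UniversalCellsCampaignW82DifferentialCriterionSeparatingScheme
import Summits.ResolutionOfSingularities.ResolutionOfSingularities.Theorems.UniversalCellsPrimeFieldToPerfectOfSmoothTwist
import Literature.AlgebraicGeometry.HodgeTheory.AlgebraicityLocusCurves
import HarnessLib

/-!
# [OURS · L1 W8.2] The crux `PrimeFieldToPerfect` from the kernel `SmoothTwist` in 1-FORM form: «a REGULAR model
# over a finite purely inseparable `K'/K` on which `dx_1 ∧ … ∧ dx_r` vanishes nowhere» (any `p`-rank `r`)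

Cell `res-hironaka` (run/shared/lean/pub/res-hironaka/), LADDER-RESOLUTION rung L (RESCUE), slot W8.2; host route
`UniversalCells`, host item `PrimeFieldToPerfect` (stmt-ResolutionOfSingularities-15233), door 1. Links leaf
(imports the Theses cone through `…PrimeFieldToPerfectOfSmoothTwist`, exactly like the gens 5–6 leaves
`…RegularTwistLinks` / `…DiagonalCriterionLinks`), written by res-L1-s82-pv-1 (gen 7), over the Theses-free scheme
form `…DifferentialCriterionSeparatingScheme`.

* **`primeFieldToPerfect_of_oneFormTwist`** — `UniversalCells.PrimeFieldToPerfect` from the kernel `SmoothTwist`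
  of Cruxes/PrimeFieldToPerfect/KERNEL.md §1 (finitely generated `K` of ANY `p`-rank) with «`Y` SMOOTH over `K'`»
  replaced by «`Y` REGULAR and, for some perfect subfield `k₀ ⊆ K'` over which `K'` is essentially of finite type
  and some separating transcendence basis `x` of `K'/k₀`, the `d(x_i)` are linearly independent at every point of
  `Y`» — form (E6) of KERNEL.md §2 («`dt_1 ∧ … ∧ dt_r` nowhere zero on `Y` in `Ω^r_{Y/𝔽_p}`»), composed with
  `Theorems.PrimeFieldToPerfect.primeFieldToPerfect_of_smoothTwist` (gens 0–1).

HONEST FRAMING. OURS theorem; NOT a statement of [Hironaka2017]; nothing attributed to its author. A reformulated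
sufficient condition, not progress on the open residual. AI work, weaker than expert review; no claim beyond the
kernel. No `sorry`, no new axioms.
-/

noncomputable section

set_option linter.dupNamespace false -- mandated namespace of this single-conjunct summit

open CategoryTheory CategoryTheory.Limits AlgebraicGeometry TopologicalSpace TensorProduct IsLocalRing
open Literature.AlgebraicGeometry.Resolution

namespace Summit.ResolutionOfSingularities.ResolutionOfSingularities.Theorems.CampaignW82

/-! ## The crux from the kernel in 1-form form -/

/-- **`PrimeFieldToPerfect` from the kernel `SmoothTwist` in 1-FORM form.** If, for every prime `p`, resolution
of integral separated finite-type schemes over `Spec (ZMod p)` and over every finitely generated field of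
characteristic `p` implies that every separated finite-type `X₀` over a finitely generated `K` which is integral
over some perfect purely inseparable `L ⊇ K` acquires, over some FINITE purely inseparable `K'/K`, a proper
birational model `Y → X₀ ×_K K'` which is a REGULAR scheme such that, for some perfect subfield `k₀` of `K'` over
which `K'` is essentially of finite type and some finite separating transcendence basis `x` of `K'/k₀`, the
1-forms `d(x_i)` are linearly independent at every point of `Y` — then `UniversalCells.PrimeFieldToPerfect` holds
(`primeFieldToPerfect_of_smoothTwist` with smoothness of `Y/K'` supplied by the 1-form criterion).
[cite: EGA0IV, Thm. 20.5.7] -/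
theorem primeFieldToPerfect_of_oneFormTwist
    (hST : ∀ (p : ℕ), p.Prime →
      (∀ (X : Scheme.{0}) (f : X ⟶ Spec (.of (ZMod p))), IsSeparated f → LocallyOfFiniteType f →
        QuasiCompact f → IsIntegral X → Scheme.HasResolution X) →
      (∀ (K : Type) [Field K] [CharP K p], (∃ s : Finset K, Subfield.closure (s : Set K) = ⊤) →
        ∀ (X : Scheme.{0}) (f : X ⟶ Spec (.of K)), IsSeparated f → LocallyOfFiniteType f →
          QuasiCompact f → IsIntegral X → Scheme.HasResolution X) →
      ∀ (K : Type) [Field K] [CharP K p], (∃ s : Finset K, Subfield.closure (s : Set K) = ⊤) →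
        ∀ (X₀ : Scheme.{0}) (f₀ : X₀ ⟶ Spec (.of K)),
          IsSeparated f₀ → LocallyOfFiniteType f₀ → QuasiCompact f₀ →
          (∃ (L : Type) (_ : Field L) (_ : PerfectField L) (_ : Algebra K L)
              (_ : IsPurelyInseparable K L),
              IsIntegral (pullback f₀ (Spec.map (CommRingCat.ofHom (algebraMap K L))))) →
          ∃ (K' : Type) (_ : Field K') (_ : Algebra K K') (_ : IsPurelyInseparable K K')
            (_ : Module.Finite K K') (Y : Scheme.{0})
            (π : Y ⟶ pullback f₀ (Spec.map (CommRingCat.ofHom (algebraMap K K')))),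
            IsProper π ∧ IsBirational π ∧ Scheme.IsRegular Y ∧
              ∃ (k₀ : Type) (_ : Field k₀) (_ : PerfectField k₀) (_ : Algebra k₀ K')
                (_ : Algebra.EssFiniteType k₀ K') (ι : Type) (_ : Fintype ι) (x : ι → K')
                (_ : AlgebraicIndependent k₀ x)
                (_ : Algebra.IsSeparable (IntermediateField.adjoin k₀ (Set.range x)) K'),
                ∀ y : Y,
                  letI q := π ≫ pullback.snd f₀ (Spec.map (CommRingCat.ofHom (algebraMap K K')))
                  letI φ := ((Scheme.ΓSpecIso (.of K')).inv ≫ q.appTop ≫ Y.presheaf.germ ⊤ y trivial).hom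
                  letI : Algebra K' (Y.presheaf.stalk y) := φ.toAlgebra
                  letI : Algebra k₀ (Y.presheaf.stalk y) := (φ.comp (algebraMap k₀ K')).toAlgebra
                  LinearIndependent (ResidueField (Y.presheaf.stalk y))
                    (fun i => (1 : ResidueField (Y.presheaf.stalk y)) ⊗ₜ[Y.presheaf.stalk y]
                      KaehlerDifferential.D k₀ (Y.presheaf.stalk y) (φ (x i)))) :
    Summit.ResolutionOfSingularities.ResolutionOfSingularities.Theses.UniversalCells.PrimeFieldToPerfect := by
  refine PrimeFieldToPerfect.primeFieldToPerfect_of_smoothTwist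
    fun p hp h₀ hfg K _ _ hK X₀ f₀ hs hl hq hint => ?_
  obtain ⟨K', _, _, _, _, Y, π, hπ, hb, hreg, k₀, _, _, _, _, ι, _, x, hx, _, h⟩ :=
    hST p hp h₀ hfg K hK X₀ f₀ hs hl hq hint
  refine ⟨K', inferInstance, inferInstance, inferInstance, inferInstance, Y, π, hπ, hb, ?_⟩
  haveI := hl
  haveI := hπ
  haveI : LocallyOfFiniteType (pullback.snd f₀ (Spec.map (CommRingCat.ofHom (algebraMap K K')))) :=
    MorphismProperty.pullback_snd _ _ inferInstance
  haveI : LocallyOfFinitePresentation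
      (π ≫ pullback.snd f₀ (Spec.map (CommRingCat.ofHom (algebraMap K K')))) :=
    Literature.AlgebraicGeometry.HodgeTheory.locallyOfFinitePresentation_of_isLocallyNoetherian _
  exact (smooth_iff_isRegular_and_forall_linearIndependent_D
    (π ≫ pullback.snd f₀ (Spec.map (CommRingCat.ofHom (algebraMap K K')))) hx).mpr ⟨hreg, h⟩

end Summit.ResolutionOfSingularities.ResolutionOfSingularities.Theorems.CampaignW82
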